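import Summits.CriticalPhenomena.PercolationContinuityZ3.Theorems.PercNearOneGluingNoHeavyLowerTailQ44PortTransfer
import Summits.CriticalPhenomena.PercolationContinuityZ3.Theorems.PercNearOneGluingNoHeavyLowerTailQ44PortStarZero
import HarnessLib

/-!
# Conjecture W (row `Q44`, all `n`) whenever every neighbour of `a` is a terminal — the turnkey form of THEOREM T_a

Support file for crux `stmt-CriticalPhenomena-4575`, seat `prim-l12-p6` gen 27; memo `run/shared/lean/prim/prim-l12/FROM-prim-l12-p6-g27-PORT-TRANSFER.md` §3.
`ConjWPort.q44_cells_of_terminal_ports` (`…Q44PortTransfer`) + `ConjWPort.real_openConn_update₃_eq_zero` (`…Q44PortStarZero`): if `w s(a,u) = 0` for every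
`u ∉ {a,b,c,y}` (and `a ∉ {b,c,y}`), Conjecture W holds for `(a,b,c,y)` under `w`, whatever the weights of `s(a,b), s(a,c), s(a,y)` and of all other pairs.
No sorries, no named facts, no definitions, standard axioms.
-/

noncomputable section

namespace Summit.CriticalPhenomena.PercolationContinuityZ3.Theorems

namespace ConjWPort

open MeasureTheory Set Literature.Probability.LatticeModels Literature.Probability.Percolation
open FourPointAtoms
open scoped Classical

variable {n : ℕ}

/-- **Conjecture W (row `Q44`, all `n`) whenever every neighbour of `a` of positive weight is a terminal** (`N(a) ⊆ {b,c,y}`, any weights on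
`s(a,b), s(a,c), s(a,y)`; `a, b, c, y` with `a ∉ {b,c,y}`): the literal cell form of Conjecture W.  (= `q44_cells_of_terminal_ports` + the star lemma.) [this work] -/
theorem q44_cells_of_nbrs_terminal (w : Sym2 (Fin n) → unitInterval) (a b c y : Fin n) (hab : a ≠ b) (hac : a ≠ c) (hay : a ≠ y)
    (h0 : ∀ u, u ≠ a → u ≠ b → u ≠ c → u ≠ y → (w s(a, u) : ℝ) = 0) :
    2 * (cell w a b c y 11 * cell w a b c y 9 + cell w a b c y 11 * cell w a b c y 8 + cell w a b c y 6 * cell w a b c y 8 + cell w a b c y 6 * cell w a b c y 1 + cell w a b c y 1 * cell w a b c y 8) +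
        (cell w a b c y 2 * cell w a b c y 13 + cell w a b c y 1 * cell w a b c y 13 + cell w a b c y 5 * cell w a b c y 12 + cell w a b c y 1 * cell w a b c y 12 + cell w a b c y 6 * cell w a b c y 10 + cell w a b c y 6 * cell w a b c y 7 +
          cell w a b c y 2 * cell w a b c y 10 + cell w a b c y 5 * cell w a b c y 7) ≤
      2 * ((cell w a b c y 11 + cell w a b c y 14) * cell w a b c y 0) :=
  q44_cells_of_terminal_ports w a b c y (real_openConn_update₃_eq_zero w a b c y h0 hab) (real_openConn_update₃_eq_zero w a b c y h0 hac)
    (real_openConn_update₃_eq_zero w a b c y h0 hay)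

end ConjWPort

end Summit.CriticalPhenomena.PercolationContinuityZ3.Theorems
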